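import Summits.ABC.ABC.Theses.IsogenyGlueCongruence
import Summits.ABC.ABC.Theorems.DefiniteXiDefiniteRTControlPrimeTwoFacts
import Summits.ABC.ABC.Theorems.DefiniteXiDefiniteRTControlPrimeOfTakahashi
import Literature.NumberTheory.EllipticCurves.ManinConstantArbitraryParametrizationIntegralProofs
import HarnessLib

/-!
# stub-ideation k1 g17 — the import doors for `stub_pasten163`, the interim 2-fact closer and the
# landed Takahashi-only closer, re-elaborated 2026-09-01 (sanity only; no new mathematics).
-/

set_option linter.dupNamespace false

namespace Summit.ABC.ABC.Cruxes.DefiniteRTControlPrime.StubIdeasK1G17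

open Literature.NumberTheory.EllipticCurves Literature.NumberTheory.EllipticCurves.ModularForms
open Summit.ABC.ABC.Theses.DefiniteXi (DefiniteRTControlPrime)

/-- Door 1: the verbatim stub IS route item `MazurKenkuBound` (stmt-ABC-15125, decl shared by the
routes DefiniteXi and IsogenyGlueCongruence), definitionally
(the tree's `DefiniteXiXiStrongBoundItemsCalibration.mazurKenkuBound_iff` is `Iff.rfl`). -/
theorem stub_pasten163_of_item (h : Summit.ABC.ABC.Theses.DefiniteXi.MazurKenkuBound) :
    PastenShimura2024_minimalDegree_le_163_mul :=
  h

/-- Door 1′: the same from the `IsogenyGlueCongruence` copy of the item decl. -/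
theorem stub_pasten163_of_item' (h : Summit.ABC.ABC.Theses.IsogenyGlueCongruence.MazurKenkuBound) :
    PastenShimura2024_minimalDegree_le_163_mul :=
  h

/-- Door 2: the verbatim stub from the ONE named fact `mazurKenku_exists_cyclic_isogeny`
(Mazur 1978 Thm 1 + Kenku 1982); the Edixhoven/Stevens integrality input is discharged in the tree. -/
theorem stub_pasten163_of_fact (hMK : mazurKenku_exists_cyclic_isogeny) :
    PastenShimura2024_minimalDegree_le_163_mul :=
  PastenShimura2024_minimalDegree_le_163_mul_of_mazurKenku' hMK

/-- Interim composition over the LANDED 2-fact closer (p838145): crux from `stub_takahashi` and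
`stub_pasten163` only (`stub_pastenLemma68` already redundant). -/
theorem crux_of_two_stubs (hT : takahashi2001_thm_2_3_of_coprime)
    (h163 : PastenShimura2024_minimalDegree_le_163_mul) : DefiniteRTControlPrime :=
  Summit.ABC.ABC.Theorems.DefiniteRTControlPrime.definiteRTControlPrime_of_two_facts hT h163

/-- Final state (p839521, 2026-09-01T01:20Z): the crux from `stub_takahashi` ALONE — `stub_pasten163`
is no longer on any closing path. -/
theorem crux_of_one_stub (hT : takahashi2001_thm_2_3_of_coprime) : DefiniteRTControlPrime :=
  Summit.ABC.ABC.Theorems.DefiniteRTControlPrime.definiteRTControlPrime_of_takahashi hT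

end Summit.ABC.ABC.Cruxes.DefiniteRTControlPrime.StubIdeasK1G17
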